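import Literature.NumberTheory.LFunctions.PsiOscillationFromZero

/-!
# `ConeMagnification`: the fake Chebyshev function `ψ_c` and the Mellin transform of the comparison
function `κ x^b − η(ψ − ψ_c)` (route `SignCone`, item stmt-RiemannHypothesis-16303; HELPER file, `--supports`)

Inputs of the fake-weight version of MV Theorem 15.3 (`SignConeConeMagnificationFakePsi.lean`, next file):
for a weight `c ≥ 0` whose `L`-series converges absolutely on `re s > 1`, the fake Chebyshev function
`ψ_c(x) = Σ_{1 ≤ n ≤ x} c(n)` is monotone, measurable and `O(x^{3/2})` (`exists_fakePsi_le`), its Mellin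
transform is `∫_{(1,∞)} ψ_c(x) x^{-(s+1)} dx = L_c(s)/s` for `re s > 3/2` (`mellinIoi_fakePsi`, MV Thm 1.3 via
Mathlib's `LSeries_eq_mul_integral_of_nonneg`), and for `F_c = L_c − 1/(s−1)` on `re s > 1` the comparison
function `A(x) = κ x^b − η(ψ(x) − ψ_c(x))` of Landau's method has
`∫_{(1,∞)} A(x) x^{-(s+1)} dx = κ/(s − b) + η (F_c(s) + ζ₁'/ζ₁(s))/s` for `re s > 2` (`mellinIoi_fakeCmp`;
`ζ₁ = (s−1)ζ` is Mathlib's `riemannZeta₁`; MV (15.6) with `1 ↦ F_c`), and `|A(x)| ≤ (κ + 7 + S) x^{3/2}`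
(`abs_fakeCmp_le`).
-/

noncomputable section

-- `Summit.RiemannHypothesis.RiemannHypothesis.…` repeats a namespace component by design (D-0017 layout).
set_option linter.dupNamespace false

open scoped BigOperators ComplexConjugate Topology
open Complex Filter Topology Set MeasureTheory Metric

namespace Summit.RiemannHypothesis.RiemannHypothesis.Theorems.SignConeConeMagnification

open Literature.NumberTheory.LFunctions
open Literature.NumberTheory.LFunctions.Landau
open Literature.NumberTheory.LFunctions.PsiOscillation

/-! ## The fake Chebyshev function `ψ_c(x) = Σ_{1 ≤ n ≤ x} c(n)` -/

/-- `ψ_c` is monotone for `c ≥ 0`. [folklore] -/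
theorem monotone_fakePsi {c : ℕ → ℝ} (hc0 : ∀ n, 0 ≤ c n) :
    Monotone fun x : ℝ ↦ ∑ n ∈ Finset.Icc 1 ⌊x⌋₊, c n := fun _ _ hxy ↦
  Finset.sum_le_sum_of_subset_of_nonneg (Finset.Icc_subset_Icc_right (Nat.floor_le_floor hxy))
    fun n _ _ ↦ hc0 n

/-- `ψ_c` is measurable (it is monotone). [folklore] -/
theorem measurable_fakePsi {c : ℕ → ℝ} (hc0 : ∀ n, 0 ≤ c n) :
    Measurable fun x : ℝ ↦ ∑ n ∈ Finset.Icc 1 ⌊x⌋₊, c n :=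
  (monotone_fakePsi hc0).measurable

/-- **A priori bound** `ψ_c(x) ≤ S x^{3/2}` (`x ≥ 1`) from absolute convergence of `L_c` at `3/2`,
`S = Σ c(n) n^{-3/2}`. [folklore] -/
theorem exists_fakePsi_le {c : ℕ → ℝ} (hc0 : ∀ n, 0 ≤ c n)
    (hsum : ∀ σ : ℝ, 1 < σ → LSeriesSummable (fun n => ((c n : ℝ) : ℂ)) σ) :
    ∃ S : ℝ, 0 ≤ S ∧ ∀ x : ℝ, 1 ≤ x → ∑ n ∈ Finset.Icc 1 ⌊x⌋₊, c n ≤ S * x ^ (3 / 2 : ℝ) := by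
  -- the real series `Σ c(n) n^{-3/2}`
  set a : ℕ → ℝ := fun n ↦ if n = 0 then 0 else c n / (n : ℝ) ^ (3 / 2 : ℝ) with ha
  have hterm : ∀ n : ℕ, LSeries.term (fun n => ((c n : ℝ) : ℂ)) (3 / 2 : ℝ) n = ((a n : ℝ) : ℂ) := by
    intro n
    rcases eq_or_ne n 0 with rfl | hn
    · simp [ha]
    · simp only [ha, if_neg hn, LSeries.term_of_ne_zero hn]
      rw [← Complex.ofReal_natCast, ← Complex.ofReal_cpow (Nat.cast_nonneg n), ← Complex.ofReal_div]
  have hS : Summable a := by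
    have h := hsum (3 / 2) (by norm_num)
    rw [LSeriesSummable, funext hterm] at h
    exact (Complex.summable_ofReal).1 h
  have ha0 : ∀ n, 0 ≤ a n := fun n ↦ by
    simp only [ha]; split_ifs
    · exact le_rfl
    · exact div_nonneg (hc0 n) (Real.rpow_nonneg (Nat.cast_nonneg n) _)
  refine ⟨∑' n, a n, tsum_nonneg ha0, fun x hx ↦ ?_⟩
  have hx0 : 0 < x := by linarith
  calc ∑ n ∈ Finset.Icc 1 ⌊x⌋₊, c n ≤ ∑ n ∈ Finset.Icc 1 ⌊x⌋₊, a n * x ^ (3 / 2 : ℝ) := by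
        refine Finset.sum_le_sum fun n hn ↦ ?_
        rw [Finset.mem_Icc] at hn
        have hn0 : n ≠ 0 := by omega
        have hnpos : (0 : ℝ) < n := by exact_mod_cast Nat.pos_of_ne_zero hn0
        have hnx : (n : ℝ) ≤ x := (Nat.cast_le.2 hn.2).trans (Nat.floor_le hx0.le)
        simp only [ha, if_neg hn0]
        rw [div_mul_eq_mul_div, le_div_iff₀ (Real.rpow_pos_of_pos hnpos _)]
        exact mul_le_mul_of_nonneg_left (Real.rpow_le_rpow hnpos.le hnx (by norm_num)) (hc0 n)
    _ = (∑ n ∈ Finset.Icc 1 ⌊x⌋₊, a n) * x ^ (3 / 2 : ℝ) := (Finset.sum_mul _ _ _).symm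
    _ ≤ (∑' n, a n) * x ^ (3 / 2 : ℝ) :=
        mul_le_mul_of_nonneg_right (hS.sum_le_tsum _ fun n _ ↦ ha0 n) (Real.rpow_nonneg hx0.le _)

/-- **MV Theorem 1.3 for `ψ_c`**: `∫_{(1,∞)} ψ_c(x) x^{-(s+1)} dx = L_c(s)/s` for `re s > 3/2`
(Mathlib's `LSeries_eq_mul_integral_of_nonneg`, partial sums `O(n^{3/2})`). [folklore] -/
theorem mellinIoi_fakePsi {c : ℕ → ℝ} (hc0 : ∀ n, 0 ≤ c n)
    (hsum : ∀ σ : ℝ, 1 < σ → LSeriesSummable (fun n => ((c n : ℝ) : ℂ)) σ) {s : ℂ} (hs : 3 / 2 < s.re) :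
    mellinIoi (fun x : ℝ ↦ ∑ n ∈ Finset.Icc 1 ⌊x⌋₊, c n) s = LSeries (fun n => ((c n : ℝ) : ℂ)) s / s := by
  obtain ⟨S, -, hSle⟩ := exists_fakePsi_le hc0 hsum
  have hO : (fun n : ℕ ↦ ∑ k ∈ Finset.Icc 1 n, c k) =O[atTop] fun n ↦ (n : ℝ) ^ (3 / 2 : ℝ) := by
    refine Asymptotics.IsBigO.of_bound S ?_
    filter_upwards [eventually_ge_atTop 1] with n hn
    rw [Real.norm_eq_abs, Real.norm_eq_abs, abs_of_nonneg (Finset.sum_nonneg fun k _ ↦ hc0 k),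
      abs_of_nonneg (Real.rpow_nonneg (Nat.cast_nonneg n) _)]
    have := hSle n (by exact_mod_cast hn)
    rwa [Nat.floor_natCast] at this
  have hL := LSeries_eq_mul_integral_of_nonneg c (by norm_num : (0 : ℝ) ≤ 3 / 2) hs hO hc0
  have hs0 : s ≠ 0 := by rintro rfl; simp at hs; linarith
  unfold mellinIoi
  rw [hL]
  push_cast
  field_simp

/-- `∫_{(1,∞)} ψ_c(x) x^{-(s+1)} dx = L_c(s)/s` for `re s > 3/2` (MV Thm 1.3 for the fake Chebyshev function;
`mellinIoi_fakePsi` in closed form). [folklore] -/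
theorem mellinIoi_fakePsi_eq :
    ∀ c : ℕ → ℝ, (∀ n, 0 ≤ c n) → (∀ σ : ℝ, 1 < σ → LSeriesSummable (fun n => ((c n : ℝ) : ℂ)) σ) →
    ∀ s : ℂ, 3 / 2 < s.re →
      Literature.NumberTheory.LFunctions.Landau.mellinIoi (fun x : ℝ => ∑ n ∈ Finset.Icc 1 ⌊x⌋₊, c n) s =
        LSeries (fun n => ((c n : ℝ) : ℂ)) s / s :=
  fun _ hc0 hsum _ hs ↦ mellinIoi_fakePsi hc0 hsum hs

/-! ## The comparison function `A(x) = κ x^b − η (ψ(x) − ψ_c(x))` of Landau's method -/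

/-- `|κ x^b − η(ψ(x) − ψ_c(x))| ≤ (κ + 7 + S) x^{3/2}` on `(1, ∞)` (for `κ ≥ 0`, `b ≤ 3/2`, `|η| = 1`,
`|ψ(x) − x| ≤ 6x`, `ψ_c(x) ≤ S x^{3/2}`). [folklore] -/
theorem abs_fakeCmp_le {c : ℕ → ℝ} (hc0 : ∀ n, 0 ≤ c n) {S : ℝ}
    (hSle : ∀ x : ℝ, 1 ≤ x → ∑ n ∈ Finset.Icc 1 ⌊x⌋₊, c n ≤ S * x ^ (3 / 2 : ℝ))
    {κ b η : ℝ} (hκ0 : 0 ≤ κ) (hb : b ≤ 3 / 2) (hη : η = 1 ∨ η = -1) {x : ℝ} (hx : 1 < x) :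
    |κ * x ^ b - η * (Chebyshev.psi x - ∑ n ∈ Finset.Icc 1 ⌊x⌋₊, c n)| ≤ (κ + 7 + S) * x ^ (3 / 2 : ℝ) := by
  have hηabs : |η| = 1 := by rcases hη with rfl | rfl <;> norm_num
  have hx0 : 0 < x := by linarith
  have hxb : x ^ b ≤ x ^ (3 / 2 : ℝ) := Real.rpow_le_rpow_of_exponent_le hx.le hb
  have hxx : x ≤ x ^ (3 / 2 : ℝ) := by
    calc x = x ^ (1 : ℝ) := (Real.rpow_one x).symm
      _ ≤ x ^ (3 / 2 : ℝ) := Real.rpow_le_rpow_of_exponent_le hx.le (by norm_num)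
  have hψ : |Chebyshev.psi x - x| ≤ 6 * x := Nicolas.abs_psi_sub_self_le hx0.le
  have hψ' : |Chebyshev.psi x| ≤ 7 * x := by
    have := abs_sub_abs_le_abs_sub (Chebyshev.psi x) x
    rw [abs_of_pos hx0] at this
    linarith
  have hP0 : 0 ≤ ∑ n ∈ Finset.Icc 1 ⌊x⌋₊, c n := Finset.sum_nonneg fun k _ ↦ hc0 k
  have hPx : |∑ n ∈ Finset.Icc 1 ⌊x⌋₊, c n| ≤ S * x ^ (3 / 2 : ℝ) := by
    rw [abs_of_nonneg hP0]; exact hSle x hx.le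
  calc |κ * x ^ b - η * (Chebyshev.psi x - ∑ n ∈ Finset.Icc 1 ⌊x⌋₊, c n)|
      ≤ |κ * x ^ b| + |η * (Chebyshev.psi x - ∑ n ∈ Finset.Icc 1 ⌊x⌋₊, c n)| := abs_sub _ _
    _ = κ * x ^ b + |Chebyshev.psi x - ∑ n ∈ Finset.Icc 1 ⌊x⌋₊, c n| := by
        rw [abs_mul, abs_mul, hηabs, one_mul, abs_of_nonneg hκ0, abs_of_nonneg (Real.rpow_nonneg hx0.le _)]
    _ ≤ κ * x ^ (3 / 2 : ℝ) + (7 * x ^ (3 / 2 : ℝ) + S * x ^ (3 / 2 : ℝ)) := by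
        refine add_le_add (mul_le_mul_of_nonneg_left hxb hκ0) ((abs_sub _ _).trans ?_)
        exact add_le_add (hψ'.trans (by nlinarith)) hPx
    _ = (κ + 7 + S) * x ^ (3 / 2 : ℝ) := by ring

/-- **MV (15.6) for the fake weight, on the half-plane of absolute convergence**: for `re s > 2`,
`∫_{(1,∞)} (κ x^b − η(ψ − ψ_c)) x^{-(s+1)} dx = κ/(s − b) + η (F_c(s) + ζ₁'/ζ₁(s))/s`, where
`F_c = L_c − 1/(s−1)` on `re s > 1` (`L_Λ = −ζ'/ζ = 1/(s−1) − ζ₁'/ζ₁`). [folklore] -/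
theorem mellinIoi_fakeCmp {c : ℕ → ℝ} (hc0 : ∀ n, 0 ≤ c n)
    (hsum : ∀ σ : ℝ, 1 < σ → LSeriesSummable (fun n => ((c n : ℝ) : ℂ)) σ)
    {Fc : ℂ → ℂ} (hFcL : ∀ s : ℂ, 1 < s.re → Fc s = LSeries (fun n => ((c n : ℝ) : ℂ)) s - 1 / (s - 1))
    (κ η : ℝ) {b : ℝ} (hb1 : b < 1) {s : ℂ} (hs2 : 2 < s.re) :
    mellinIoi (fun x : ℝ ↦ κ * x ^ b - η * (Chebyshev.psi x - ∑ n ∈ Finset.Icc 1 ⌊x⌋₊, c n)) s =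
      κ / (s - b) + η * ((Fc s + logDeriv riemannZeta₁ s) / s) := by
  set P : ℝ → ℝ := fun x ↦ ∑ n ∈ Finset.Icc 1 ⌊x⌋₊, c n with hPdef
  have hPm : Measurable P := measurable_fakePsi hc0
  obtain ⟨S, -, hSle⟩ := exists_fakePsi_le hc0 hsum
  have hP0 : ∀ x, 0 ≤ P x := fun x ↦ Finset.sum_nonneg fun k _ ↦ hc0 k
  have hs1 : 1 < s.re := by linarith
  have hs0 : s ≠ 0 := by rintro rfl; simp at hs2; linarith
  have hsb : s - (b : ℂ) ≠ 0 := by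
    intro h; have := congrArg Complex.re h; simp at this; linarith
  have hs1' : s - 1 ≠ 0 := by
    intro h; have := congrArg Complex.re h; simp at this; linarith
  -- integrability of the three pieces at `s`
  have hIpow : Integrable (fun x : ℝ ↦ ((κ * x ^ b : ℝ) : ℂ) * (x : ℂ) ^ (-(s + 1)))
      (volume.restrict (Ioi 1)) := by
    refine integrable_ofReal_mul_cpow_of_re
      (show Measurable (fun x : ℝ ↦ κ * x ^ b) from measurable_const.mul (measurable_id.pow_const _)) ?_
    exact Nicolas.integrableOn_const_mul_rpow κ (PsiOmega.integrableOn_rpow_rpow (b := b) (σ := s.re) (by linarith))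
  have hIψ : Integrable (fun x : ℝ ↦ ((Chebyshev.psi x : ℝ) : ℂ) * (x : ℂ) ^ (-(s + 1)))
      (volume.restrict (Ioi 1)) := by
    refine Nicolas.integrable_ofReal_mul_cpow Nicolas.measurable_psi (σ₁ := (1 + s.re) / 2) ?_
      (by linarith)
    have ha := PsiOmega.integrableOn_psi_sub_self_rpow (σ := (1 + s.re) / 2) (by linarith)
    have hb := PsiOmega.integrableOn_rpow_rpow (b := 1) (σ := (1 + s.re) / 2) (by linarith)
    refine (Nicolas.integrableOn_add_rpow ha hb).congr_fun (fun x _ ↦ ?_) measurableSet_Ioi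
    simp only [Real.rpow_one, sub_add_cancel]
  have hIP : Integrable (fun x : ℝ ↦ ((P x : ℝ) : ℂ) * (x : ℂ) ^ (-(s + 1))) (volume.restrict (Ioi 1)) := by
    refine Nicolas.integrable_ofReal_mul_cpow hPm (σ₁ := (3 / 2 + s.re) / 2) ?_ (by linarith)
    have h1 : IntegrableOn (fun x : ℝ ↦ S * (x ^ (3 / 2 : ℝ) * x ^ (-((3 / 2 + s.re) / 2 + 1)))) (Ioi 1) :=
      (PsiOmega.integrableOn_rpow_rpow (by linarith)).const_mul _
    refine Integrable.mono' h1 ((hPm.mul (measurable_id.pow_const _))).aestronglyMeasurable ?_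
    rw [ae_restrict_iff' measurableSet_Ioi]
    refine Eventually.of_forall fun x (hx : 1 < x) ↦ ?_
    have hx0 : 0 < x := zero_lt_one.trans hx
    rw [norm_mul, Real.norm_eq_abs, Real.norm_eq_abs, abs_of_pos (Real.rpow_pos_of_pos hx0 _),
      abs_of_nonneg (hP0 x)]
    calc P x * x ^ (-((3 / 2 + s.re) / 2 + 1)) ≤ S * x ^ (3 / 2 : ℝ) * x ^ (-((3 / 2 + s.re) / 2 + 1)) :=
          mul_le_mul_of_nonneg_right (hSle x hx.le) (Real.rpow_nonneg hx0.le _)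
      _ = _ := by ring
  have hIdiff : Integrable (fun x : ℝ ↦ ((η * (Chebyshev.psi x - P x) : ℝ) : ℂ) * (x : ℂ) ^ (-(s + 1)))
      (volume.restrict (Ioi 1)) := by
    have := (hIψ.sub hIP).const_mul (η : ℂ)
    refine this.congr (Eventually.of_forall fun x ↦ ?_)
    simp only [Pi.sub_apply]
    push_cast
    ring
  -- the three transforms
  have hMpow : mellinIoi (fun x : ℝ ↦ κ * x ^ b) s = κ / (s - b) := by
    rw [Nicolas.mellinIoi_const_mul, PsiOmega.mellinIoi_rpow (lt_trans hb1 hs1)]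
    ring
  have hMψ := PsiOmega.mellinIoi_psi hs1
  have hMP := mellinIoi_fakePsi hc0 hsum (s := s) (by linarith)
  have hMdiff : mellinIoi (fun x : ℝ ↦ η * (Chebyshev.psi x - P x)) s =
      η * ((((s - 1)⁻¹ - logDeriv riemannZeta₁ s) / s) - LSeries (fun n => ((c n : ℝ) : ℂ)) s / s) := by
    rw [Nicolas.mellinIoi_const_mul, Nicolas.mellinIoi_sub' hIψ hIP, hMψ, hMP]
  have hA' : (fun x : ℝ ↦ κ * x ^ b - η * (Chebyshev.psi x - ∑ n ∈ Finset.Icc 1 ⌊x⌋₊, c n)) =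
      fun x ↦ κ * x ^ b - η * (Chebyshev.psi x - P x) := rfl
  rw [hA', Nicolas.mellinIoi_sub' hIpow hIdiff, hMpow, hMdiff, hFcL s hs1]
  field_simp
  ring

end Summit.RiemannHypothesis.RiemannHypothesis.Theorems.SignConeConeMagnification

end
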